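import Literature.Topology.Algebra.RestrictedProduct.FinsumProdExchange
import HarnessLib

/-!
# Sum–product exchange REINDEXED: a sum over an abstract class set that is «locally a restricted product with an archimedean factor»

Topic `Topology/Algebra/RestrictedProduct`; namespace `Literature.Topology.Algebra.RestrictedProduct` (sequel of ★ `FinsumProdExchange`, A-p06 (B1)).
THEOREMS ONLY (Mathlib + ★ B1; no `def`, no named fact, no `sorry`).

THE IDENTITY.  ★ B1 `finsum_finprod_apply_eq_prod_finsum` exchanges `∑ᶠ` and `∏ᶠ` over the LITERAL restricted product `Πʳ i, [D i, A i]`.  The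
consumer's index set is not literally a restricted product: it is a set `𝒞` of (adelic conjugacy) classes which READS as one through class maps —
`π i : X → D i` («the local class at `i`») and `πₐ : X → B` («the archimedean class») — that are jointly INJECTIVE on `𝒞`, land in prescribed
«stable» subsets `St i ∋ e i`, `Stₐ`, equal the base point `e i` at all but finitely many `i`, and are jointly SURJECTIVE onto
`{δ | δ i ∈ St i, δ i = e i a.e.} × Stₐ`.  For a summand that FACTORS through the class maps, `Φ x = φₐ (πₐ x) · ∏ᶠ i, φ i (π i x)`, with B1's
triviality off a finite set `S` (on the stable sets) and finite supports:

  `∑ᶠ x ∈ 𝒞, Φ x = (∑ᶠ b ∈ Stₐ, φₐ b) * ∏ i ∈ S, ∑ᶠ d ∈ St i, φ i d`      (`finsum_mem_eq_finsum_mul_prod_finsum_of_factor`).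

Steps: `finsum_prod_mul_eq` (a finitely supported product-type sum of `g p.1 * f p.2` splits), the transfer of B1 to the subtypes `↥(St i)` with the base
singletons (`finsum_finprod_subtype_eq_prod_finsum_mem`), and the reindexing along the bijection `𝒞 ≃ Πʳ i, [St i, {e i}] × Stₐ` built from the four
hypotheses (Mathlib `finsum_eq_of_bijective`).  No junk values of `∑ᶠ`/`∏ᶠ` are used.

WHY (the consumer).  Rogawski 1990, §4.3 p. 44 ∕ §5.4 pp. 72–73: the adelic stable orbital integral `Σ_{δ ∈ 𝒞_𝐀} Φ(δ, f_∞ ⊗ ⊗_v f_v)` over the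
`G(𝐀)`-classes `𝒞_𝐀` inside an adelic stable class equals `Φ^st_∞ · ∏_v Φ^st_v` — `𝒞_𝐀` is identified with (local classes in the local stable
classes, base class a.e.) × (archimedean classes) by gluing local conjugators ([Kottwitz1986, Prop. 7.1]: integral conjugators a.e.).  This file is
the index-generic algebra of that step; the dictionary (injectivity = gluing, surjectivity = existence of adèles with prescribed components,
eventual triviality = [Kt₄] 7.1) is supplied as HYPOTHESES by the arithmetic files.

## References
* J. D. Rogawski, *Automorphic Representations of Unitary Groups in Three Variables*, Ann. of Math. Stud. 123 (1990), §4.3 p. 44, §5.4 pp. 72–73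
  [Rogawski1990].
* R. E. Kottwitz, Stable trace formula: elliptic singular terms, Math. Ann. 275 (1986), Prop. 7.1, §7.3 [Kottwitz1986].
-/

set_option autoImplicit false

open Filter Set Function
open scoped RestrictedProduct

namespace Literature.Topology.Algebra.RestrictedProduct

universe u v w

/-! ## §1 A finitely supported sum over a product type of `g p.1 * f p.2` splits -/

section Split

variable {α : Type u} {β : Type v} {R : Type w} [CommSemiring R]

/-- `∑ᶠ p : α × β, g p.1 * f p.2 = (∑ᶠ a, g a) * ∑ᶠ b, f b` for finitely supported `g`, `f` (Mathlib `finsum_curry`, `mul_finsum'`,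
`finsum_mul'`). [cite: Rogawski1990, §4.3 p. 44] -/
theorem finsum_prod_mul_eq (g : α → R) (f : β → R) (hg : (support g).Finite) (hf : (support f).Finite) :
    ∑ᶠ p : α × β, g p.1 * f p.2 = (∑ᶠ a, g a) * ∑ᶠ b, f b := by
  have hsupp : (support fun p : α × β => g p.1 * f p.2) ⊆ support g ×ˢ support f := by
    intro p hp
    simp only [mem_support, ne_eq] at hp
    exact ⟨fun h => hp (by rw [h, zero_mul]), fun h => hp (by rw [h, mul_zero])⟩
  have hfin : HasFiniteSupport fun p : α × β => g p.1 * f p.2 := (hg.prod hf).subset hsupp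
  rw [finsum_curry _ hfin]
  simp only
  have h1 : ∀ a, ∑ᶠ b, g a * f b = g a * ∑ᶠ b, f b := fun a => (mul_finsum' (f := f) (g a) hf).symm
  simp_rw [h1]
  exact (finsum_mul' _ _ hg).symm

end Split

/-! ## §2 B1 on the subtypes `↥(St i)` with base singletons, read back as `∑ᶠ d ∈ St i` -/

section Subtype

variable {ι : Type u} {D : ι → Type v} {R : Type w} [CommSemiring R]
  (St : ∀ i, Set (D i)) (e : ∀ i, D i) (he : ∀ i, e i ∈ St i) (φ : ∀ i, D i → R) (S : Finset ι)

/-- **B1 over the stable subsets**: with base points `⟨e i, he i⟩ ∈ ↥(St i)` and admissible sets the base singletons,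
`∑ᶠ δ : Πʳ i, [↥(St i), {⟨e i, _⟩}], ∏ᶠ i, φ i (δ i) = ∏ i ∈ S, ∑ᶠ d ∈ St i, φ i d` as soon as, off `S`, `φ i (e i) = 1` and `φ i` vanishes on
`St i ∖ {e i}`, and on `S` the support of `φ i` on `St i` is finite (★ `finsum_finprod_apply_eq_prod_finsum_single` on the subtypes, then
`finsum_set_coe_eq_finsum_mem`). [cite: Rogawski1990, §4.3 p. 44] [cite: Kottwitz1986, §7.3] -/
theorem finsum_finprod_subtype_eq_prod_finsum_mem (h1 : ∀ i ∉ S, φ i (e i) = 1)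
    (h0 : ∀ i ∉ S, ∀ d ∈ St i, d ≠ e i → φ i d = 0) (hfin : ∀ i ∈ S, (support (φ i) ∩ St i).Finite) :
    ∑ᶠ δ : Πʳ i, [↥(St i), ({⟨e i, he i⟩} : Set ↥(St i))], ∏ᶠ i, φ i ((δ i : ↥(St i)) : D i) =
      ∏ i ∈ S, ∑ᶠ d ∈ St i, φ i d := by
  have hB := finsum_finprod_apply_eq_prod_finsum_single (D := fun i => ↥(St i)) (R := R) (e := fun i => (⟨e i, he i⟩ : ↥(St i)))
    (φ := fun i (d : ↥(St i)) => φ i (d : D i)) (S := S) (fun i hi => h1 i hi)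
    (fun i hi d hd => h0 i hi d d.2 fun h => hd (Subtype.ext h))
    (fun i hi => by
      refine ((hfin i hi).preimage Subtype.val_injective.injOn).subset fun d hd => ?_
      exact ⟨hd, d.2⟩)
  rw [hB]
  refine Finset.prod_congr rfl fun i _ => ?_
  exact finsum_set_coe_eq_finsum_mem (St i)

end Subtype

/-! ## §3 The reindexed exchange -/

section Reindex

variable {X : Type*} {ι : Type u} {D : ι → Type v} {B : Type*} {R : Type w} [CommSemiring R]
  (𝒞 : Set X) (π : X → ∀ i, D i) (πₐ : X → B) (St : ∀ i, Set (D i)) (e : ∀ i, D i) (Stₐ : Set B)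
  (Φ : X → R) (φ : ∀ i, D i → R) (φₐ : B → R) (S : Finset ι)

/-- **The reindexed sum–product exchange.**  Let `𝒞 ⊆ X` read as a restricted product with an archimedean factor through the class maps
`π`, `πₐ`: (inj) `x ↦ (π x, πₐ x)` is injective on `𝒞`; (img) `π x i ∈ St i`, `πₐ x ∈ Stₐ` for `x ∈ 𝒞`; (ev) `π x i = e i` for all but finitely
many `i`; (surj) every `δ` with `δ i ∈ St i` for all `i` and `δ i = e i` a.e., together with every `b ∈ Stₐ`, is `(π x, πₐ x)` for some `x ∈ 𝒞`.
If `Φ x = φₐ (πₐ x) * ∏ᶠ i, φ i (π x i)` on `𝒞`, and off the finite set `S` each `φ i` is `1` at `e i` and `0` on `St i ∖ {e i}`, with finite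
supports on `S` and of `φₐ` on `Stₐ`, then `∑ᶠ x ∈ 𝒞, Φ x = (∑ᶠ b ∈ Stₐ, φₐ b) * ∏ i ∈ S, ∑ᶠ d ∈ St i, φ i d`.
[cite: Rogawski1990, §4.3 p. 44; §5.4 pp. 72–73] [cite: Kottwitz1986, Prop. 7.1] -/
theorem finsum_mem_eq_finsum_mul_prod_finsum_of_factor (he : ∀ i, e i ∈ St i)
    (hinj : Set.InjOn (fun x => (π x, πₐ x)) 𝒞)
    (himg : ∀ x ∈ 𝒞, (∀ i, π x i ∈ St i) ∧ πₐ x ∈ Stₐ)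
    (hev : ∀ x ∈ 𝒞, ∀ᶠ i in cofinite, π x i = e i)
    (hsurj : ∀ (δ : ∀ i, D i) (b : B), (∀ i, δ i ∈ St i) → (∀ᶠ i in cofinite, δ i = e i) → b ∈ Stₐ → ∃ x ∈ 𝒞, π x = δ ∧ πₐ x = b)
    (hfac : ∀ x ∈ 𝒞, Φ x = φₐ (πₐ x) * ∏ᶠ i, φ i (π x i))
    (h1 : ∀ i ∉ S, φ i (e i) = 1) (h0 : ∀ i ∉ S, ∀ d ∈ St i, d ≠ e i → φ i d = 0)
    (hfin : ∀ i ∈ S, (support (φ i) ∩ St i).Finite) (hfinₐ : (support φₐ ∩ Stₐ).Finite) :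
    ∑ᶠ x ∈ 𝒞, Φ x = (∑ᶠ b ∈ Stₐ, φₐ b) * ∏ i ∈ S, ∑ᶠ d ∈ St i, φ i d := by
  classical
  -- the target index type: the restricted product of the stable subtypes (base singletons) times the archimedean stable subtype
  set P := Πʳ i, [↥(St i), ({⟨e i, he i⟩} : Set ↥(St i))] with hP
  -- the reading map `Ψ : 𝒞 → P × Stₐ`
  let Ψ : 𝒞 → P × ↥Stₐ := fun x =>
    (⟨fun i => ⟨π x i, (himg x x.2).1 i⟩, by
        filter_upwards [hev x x.2] with i hi
        exact Set.mem_singleton_iff.2 (Subtype.ext hi)⟩,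
      ⟨πₐ x, (himg x x.2).2⟩)
  have hΨ : Function.Bijective Ψ := by
    constructor
    · intro x y hxy
      apply Subtype.ext
      apply hinj x.2 y.2
      have h₁ := congrArg (fun p : P × ↥Stₐ => fun i => ((p.1 i : ↥(St i)) : D i)) hxy
      have h₂ := congrArg (fun p : P × ↥Stₐ => (p.2 : B)) hxy
      exact Prod.ext (funext fun i => congrFun h₁ i) h₂
    · rintro ⟨δ, b⟩
      have hδ : ∀ᶠ i in cofinite, ((δ i : ↥(St i)) : D i) = e i := by
        filter_upwards [δ.2] with i hi
        exact congrArg Subtype.val (Set.mem_singleton_iff.1 hi)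
      obtain ⟨x, hx, hπ, hπₐ⟩ := hsurj (fun i => ((δ i : ↥(St i)) : D i)) b (fun i => (δ i).2) hδ b.2
      refine ⟨⟨x, hx⟩, Prod.ext ?_ (Subtype.ext hπₐ)⟩
      exact RestrictedProduct.ext _ _ fun i => Subtype.ext (congrFun hπ i)
  -- the summand on `P × Stₐ`
  let F : P × ↥Stₐ → R := fun p => (∏ᶠ i, φ i ((p.1 i : ↥(St i)) : D i)) * φₐ (p.2 : B)
  have hΦF : ∀ x : 𝒞, Φ x = F (Ψ x) := fun x => by
    rw [hfac x x.2, mul_comm]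
    rfl
  -- reindex
  rw [← finsum_set_coe_eq_finsum_mem 𝒞, finsum_eq_of_bijective Ψ hΨ hΦF]
  -- split the product-type sum
  have hg : (support fun δ : P => ∏ᶠ i, φ i ((δ i : ↥(St i)) : D i)).Finite :=
    finite_support_finprod_apply_single (D := fun i => ↥(St i)) (R := R) (e := fun i => (⟨e i, he i⟩ : ↥(St i)))
      (φ := fun i (d : ↥(St i)) => φ i (d : D i)) (S := S) (fun i hi => h1 i hi)
      (fun i hi d hd => h0 i hi d d.2 fun h => hd (Subtype.ext h))
      (fun i hi => ((hfin i hi).preimage Subtype.val_injective.injOn).subset fun d hd => ⟨hd, d.2⟩)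
  have hf : (support fun b : ↥Stₐ => φₐ (b : B)).Finite :=
    (hfinₐ.preimage Subtype.val_injective.injOn).subset fun b hb => ⟨hb, b.2⟩
  calc ∑ᶠ p : P × ↥Stₐ, F p
      = ∑ᶠ p : P × ↥Stₐ, (∏ᶠ i, φ i ((p.1 i : ↥(St i)) : D i)) * φₐ (p.2 : B) := rfl
    _ = (∑ᶠ δ : P, ∏ᶠ i, φ i ((δ i : ↥(St i)) : D i)) * ∑ᶠ b : ↥Stₐ, φₐ (b : B) :=
        finsum_prod_mul_eq (fun δ : P => ∏ᶠ i, φ i ((δ i : ↥(St i)) : D i)) (fun b : ↥Stₐ => φₐ (b : B)) hg hf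
    _ = (∏ i ∈ S, ∑ᶠ d ∈ St i, φ i d) * ∑ᶠ b ∈ Stₐ, φₐ b := by
        rw [finsum_finprod_subtype_eq_prod_finsum_mem St e he φ S h1 h0 hfin, finsum_set_coe_eq_finsum_mem Stₐ]
    _ = (∑ᶠ b ∈ Stₐ, φₐ b) * ∏ i ∈ S, ∑ᶠ d ∈ St i, φ i d := mul_comm _ _

end Reindex

end Literature.Topology.Algebra.RestrictedProduct
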